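import Mathlib
import Summits.NavierStokesRegularity.NavierStokesRegularity.Theses.FilamentSkeletonRss
import Literature.Analysis.FluidPDE.PineauVicolRDSSLeray
import Summits.NavierStokesRegularity.NavierStokesRegularity.Theorems.CorkscrewDynamoClassicalCorkscrewSuffices

/-!
# Route FilamentSkeletonRss · crux `CoreGluing` (stmt-NavierStokesRegularity-15401) — line `Sketch`,
# stub `stub_rssPackaging`

**Packaging: a classical rotated-self-similar Type-I solution is a witness of `RssProfileExists`.**

Let `U ∈ C²(ℝ³; ℝ³)` be nontrivial, `α ≠ 0`, and suppose the Pineau–Vicol ansatz field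
`u = pvAnsatz α U`, `u(t,x) = (−t)^{−1/2} R(αs) U(R(−αs)x/√(−t))`, `s = −log(−t)`, is a classical
Navier–Stokes solution (`ν = 1`, `f = 0`) on the time set `(−∞, 0)` with a pressure bounded on
every past slab `(−∞, t]`, `t < 0`, and that `‖U y‖ ≤ C₀/(1+‖y‖)`. Then `RssProfileExists` holds
with the witnesses `Rot θ = rotZLIE θ` (the rotation about `e₃`) and `u`:

* pinned rotation clauses: `rotZ θ e₀ = cos θ e₀ + sin θ e₁`, `rotZ θ e₁ = −sin θ e₀ + cos θ e₁`,
  `rotZ θ e₂ = e₂` (coordinates, `rotZ_apply_zero/one/two`);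
* `u(−1) = U` (`pvAnsatz_neg_one`);
* rotated DSS for every factor `c > 0` with rotation `R(−2α log c)`
  (`PineauVicol2026.isRotatedDSS_pvAnsatz` with the `s`-independent profile);
* Type I: `‖u(t,x)‖ ≤ C₀/(‖x‖ + √(−t))` (`norm_pvAnsatz_le_of_profile`, Pineau–Vicol Remark 1.2);
* ancient mild: Fabes–Jones–Rivière on past slabs (`isAncientMildSolution_of_classical_Iio`), the
  velocity being bounded there by Type I (`isBoundedOn_Iic_of_hasTypeIDecay`);
* slices of a classical solution are smooth, hence continuous, hence a.e.-strongly measurable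
  (`IsClassicalNSSolutionOn.contDiff_velocity`).

No named facts are used; every ingredient is a proved tree lemma.

## References

* B. Pineau, V. Vicol, arXiv:2607.09619 (2026): (1.7), (1.13), Remarks 1.2, 1.3, 1.5. [PineauVicol2026]
* E. B. Fabes, B. F. Jones, N. M. Rivière, Arch. Rational Mech. Anal. 45 (1972) 222–240, Thm. 2.1. [FabesJonesRiviere1972]
-/

noncomputable section

set_option linter.dupNamespace false

namespace Summit.NavierStokesRegularity.NavierStokesRegularity.Theorems

open Set Function Filter MeasureTheory
open Literature.Analysis.FluidPDE Literature.Analysis.FluidPDE.PineauVicol2026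
open scoped RealInnerProductSpace Laplacian ContDiff Topology

/-- The rotation `rotZLIE θ` about `e₃` is pinned on the standard basis:
`R_θ e₀ = cos θ e₀ + sin θ e₁`, `R_θ e₁ = −sin θ e₀ + cos θ e₁`, `R_θ e₂ = e₂` (coordinates). -/
theorem rssPackaging_rotZLIE_pinned (θ : ℝ) :
    rotZLIE θ (EuclideanSpace.single 0 1) =
        Real.cos θ • EuclideanSpace.single 0 1 + Real.sin θ • EuclideanSpace.single 1 1 ∧
      rotZLIE θ (EuclideanSpace.single 1 1) =
        -(Real.sin θ • EuclideanSpace.single 0 1) + Real.cos θ • EuclideanSpace.single 1 1 ∧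
      rotZLIE θ (EuclideanSpace.single 2 1) = EuclideanSpace.single 2 1 := by
  refine ⟨?_, ?_, ?_⟩
  · ext i
    fin_cases i <;> simp
  · ext i
    fin_cases i <;> simp
  · ext i
    fin_cases i <;> simp

/-- The ansatz field of an `s`-independent profile with the decay `‖U y‖ ≤ C₀/(1+‖y‖)` is Type-I
bounded: `‖u(t,x)‖ ≤ C₀/(‖x‖ + √(−t))` for `t < 0` (Pineau–Vicol 2026, Remark 1.2; tree:
`norm_pvAnsatz_le_of_profile`). -/
theorem rssPackaging_hasTypeIDecay {α C₀ : ℝ}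
    {U : EuclideanSpace ℝ (Fin 3) → EuclideanSpace ℝ (Fin 3)}
    (hdec : ∀ y : EuclideanSpace ℝ (Fin 3), ‖U y‖ ≤ C₀ / (1 + ‖y‖)) :
    HasTypeIDecay C₀ (pvAnsatz α (fun y _ => U y)) := by
  have hU' : ∀ y : EuclideanSpace ℝ (Fin 3), ‖U y‖ ≤ C₀ / (‖y‖ + 1) := fun y => by
    rw [add_comm]
    exact hdec y
  exact fun t ht x => norm_pvAnsatz_le_of_profile hU' ht x

/-- **Registered stub `stub_rssPackaging`** (line `Sketch` of the crux `CoreGluing`,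
stmt-NavierStokesRegularity-15401; packaging over proved tree facts). If `U ∈ C²` is nontrivial,
`α ≠ 0`, the ansatz field `pvAnsatz α U` is a classical Navier–Stokes solution on `(−∞, 0)` with a
pressure bounded on past slabs, and `‖U y‖ ≤ C₀/(1+‖y‖)`, then `RssProfileExists` holds, with
`Rot = rotZLIE` and `u = pvAnsatz α U`: the rotation is pinned on the standard basis
(`rssPackaging_rotZLIE_pinned`), `u(−1) = U` (`pvAnsatz_neg_one`), `u` is rotated-DSS for every
factor (`isRotatedDSS_pvAnsatz`), ancient mild (`isAncientMildSolution_of_classical_Iio`, the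
velocity bounded on past slabs by Type I, `isBoundedOn_Iic_of_hasTypeIDecay`), has continuous hence
measurable slices (`IsClassicalNSSolutionOn.contDiff_velocity`) and Type-I decay
(`rssPackaging_hasTypeIDecay`). -/
theorem stub_rssPackaging :
    ∀ (α C₀ : ℝ) (U : EuclideanSpace ℝ (Fin 3) → EuclideanSpace ℝ (Fin 3))
      (p : ℝ → EuclideanSpace ℝ (Fin 3) → ℝ), α ≠ 0 → ContDiff ℝ 2 U → U ≠ 0 →
      IsClassicalNSSolutionOn (Iio 0) 1 0 (pvAnsatz α (fun y _ => U y)) p →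
      (∀ t < 0, IsBoundedOn (Iic t) p) →
      (∀ y : EuclideanSpace ℝ (Fin 3), ‖U y‖ ≤ C₀ / (1 + ‖y‖)) →
      Summit.NavierStokesRegularity.NavierStokesRegularity.Theses.FilamentSkeletonRss.RssProfileExists := by
  intro α C₀ U p hα hU2 hU0 hcl hp hdec
  have hTI : HasTypeIDecay C₀ (pvAnsatz α (fun y _ => U y)) := rssPackaging_hasTypeIDecay hdec
  have hbd : ∀ t < 0, IsBoundedOn (Iic t) (pvAnsatz α (fun y _ => U y)) := fun t ht =>
    isBoundedOn_Iic_of_hasTypeIDecay hTI ht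
  refine ⟨α, C₀, U, fun θ => rotZLIE θ, pvAnsatz α (fun y _ => U y), hα,
    fun θ => rssPackaging_rotZLIE_pinned θ, hU2, hU0, funext fun x => pvAnsatz_neg_one α _ x,
    fun c hc => isRotatedDSS_pvAnsatz hc fun _ _ => rfl,
    isAncientMildSolution_of_classical_Iio one_pos hcl hbd hp,
    fun t ht => (hcl.contDiff_velocity ht).continuous.aestronglyMeasurable, hTI⟩

end Summit.NavierStokesRegularity.NavierStokesRegularity.Theorems
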